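import Summits.QuantumFields.BalabanUV.Beta.GAN24.Push3BorderGaugeSlotCells

/-!
# `GAN24.Push3BorderGaugeSlotCellsRight` — CT-ROUTE step «CT-3aV-NEST», part 2: THE `reslot inr inl` CHANNEL of the border table (`push₃ (rowMM K̃ Lc) R R (reslot inr inl V)`
# in leaf-01 g43's `RespStepBm.e3K_coDressKBmAt_KStepUnit`): the TABLE slot hypothesis-free, and the RIGHT slot via the TRANSPOSITION of the push on the summable class
# (`push₃ l r w (reslot inr inl V) x′ z′ α β = push₃ r l w (reslot inl inr V) z′ x′ β α` — the border table is SYMMETRIC, `vhSAt_symm`)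

HONEST FRAMING (cell charter, verbatim): «discharging `BetaPertH` makes Bałaban's UV stability UNCONDITIONAL — a real constructive-QFT result;
it is NOT the continuum limit and NOT the Clay problem.»  DERIVED cell leaf (pub-balaban, G-an2-4 formalisation swarm → CRUX TEAM (2), seat
`b2b-balaban-gan24-formalise-leaf-02`, gen 47): leaf-01 g58's `Push3GaugeSlotCells.push₃_transpose_ff` script (ONE genuine exchange of the two kernel-leg sums by
`tsum_comm_of_window` on the window `x − z ∈ [−(2L−1), 0]^{d+1}`) re-run for the symmetric, packed border table; [folklore] finite-window bookkeeping over part 1,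
`ContactBorderPartner`, `BorderGaugeLegContact`, an1's `vhSAt_symm` ∕ `locStencil_vhSAt` and leaf-17∕leaf-01's `Push4NestAux` ∕ `SrecLinearPartEq` BY NAME; NO cited
fact, NO `def`, NO `def … : Prop`, NO wall binder.  Discharges NO letter of (CONV-C); NEVER «G-an2-4 closed»; NOT hS0, NOT D1, NOT `BetaPertH`, NOT continuum,
NOT Clay.  «not in print; our bookkeeping».
HONEST DEPENDENCY (cell records, verbatim): «continuum YM on T⁴ ⇐ BetaPertH ∧ nine spine estimates (0/9 proved); BetaPertH ⇐ (D1) ∧ (D4) ∧ CAP+tail;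
G-an2-4 gates asym, D1 and NE2/3/4.»
ABSOLUTE RULE (cell charter, verbatim): «No internally-minted statement may enter as a cited fact. Every hypothesis is either kernel-proved in this
package or a verbatim quotation of a PUBLISHED theorem with page reference. The manuscript(s) under audit are NOT citable for their own disputed steps —
they are the thing under adjudication; programme-internal (2001/route/tribunal) claims are never citable.»

## What is proved (box root `ρ = toSite rr`, `rr ∈ box (d+1) L`, `1 ≤ L`; `V = vhSAt ρ d L`, `q = linSymAt ρ L`)
* §1 symmetry ∕ window ∕ size of the re-slotted channels: `reslot_inr_inl_vhSAt_eq` (`reslot inr inl V κ u x z (inl a) (inl b) = reslot inl inr V κ u z x (inl b) (inl a)`),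
  `vertexW_border_symm`, `vertexW_border_eq_zero_of_not_mem` (the `reslot inr inl` vertex vanishes unless `x − z ∈ [−(2L−1), 0]^{d+1}`), `exists_vertexW_border_bound`.
* §2 TABLE SLOT of the `reslot inr inl` channel (hypothesis-free): `vertexW_dz_border'`, **`push₃_gaugeTable_border'`**
  `push₃ l r (dz λ) (reslot inr inl V) κ′ u′ x′ z′ (inl α) (inl β) = Σ'_z Σ_b r β z′ b z · Σ'_x Σ_a l α x′ a x · ((λ_{κ′u′}(x + ρ) − λ_{κ′u′} z) · q(z,x)(inl b)(inr a))`
  — the dressed FIELD leg `r` OUTER over the fine slot, the multiplier leg `l` INSIDE over the packed slot: `ContactOneGaugeCellBorder.abs_cell_border_le`'s nesting with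
  the kernel of `ContactBorderPartner.abs_idxWeight_mul_linSymAt_le` (instance **`abs_cellVidx_le''`**).
* §3 TRANSPOSITION on the summable class (left legs with summable fine rows, right and table legs bounded): **`push₃_transpose_border`**; hence the RIGHT SLOT
  **`push₃_gaugeRight_border`** `push₃ l (dz λ) w (reslot inr inl V) κ′ u′ x′ z′ (inl α) (inl β) = Σ'_x Σ_a l α x′ a x · Σ'_u Σ_κ w κ′ u′ κ u · ((λ_{βz′}(u + e_κ) − λ_{βz′}(x + ρ + L·e_a)) · q(u,x)(inl κ)(inr a))`
  — multiplier leg `l` OUTER: part 1's `abs_cellVflu_le'` bounds it.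
Provenance: seat b2b-balaban-gan24-formalise-leaf-02 gen 47 (prover-…-leaf-02-g47-0), 2026-08-21; over the files named above BY NAME.
-/

open Finset
open scoped BigOperators Nat
open Literature.MathematicalPhysics.QuantumFieldTheory.LatticeForm (quo)
open Literature.MathematicalPhysics.QuantumFieldTheory.Balaban1983to89
open Literature.MathematicalPhysics.QuantumFieldTheory.Balaban1983to89.Beta
open AffineAveraging AveragingContours AveragingHessianKernels AveragingContoursRooted AveragingHessianKernelsRooted
open B12Sec2to5 (l1 l1_nonneg)
open B4ContourShift (supNorm supNorm_nonneg)
open ExpKernelCalculus (MKer Decays Zl Zl_nonneg Zl_pos)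
open OneStepResolventKernel (Fib LocStencil)
open Summit.QuantumFields.BalabanUV.Beta.AveragingWardRootedStencils (linSymAt linSymAt_inl_inr linSymAt_inr_inl linSymAt_symm legSite)
open StepJetData (mfNeg mfNeg_inr_inl)
open Summit.QuantumFields.BalabanUV.Beta.LinearGaugeVH (nearBox mem_nearBox summable_of_finsupp)
open Summit.QuantumFields.BalabanUV.Beta.GAN24.BorderGaugeLegContact (vhSAt_inl_inr_eq_zero_of_not_mem)
open Summit.QuantumFields.BalabanUV.Beta.GAN24.ContactBorderPartner (tsum_dz_mul_vhSAt_idx abs_idxWeight_mul_linSymAt_le)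
open Summit.QuantumFields.BalabanUV.Beta.GAN24.ContactOneGaugeCellBorder (abs_cell_border_le)
open Summit.QuantumFields.BalabanUV.Beta.GAN24.Push4 (vertexW vertexW_apply)
open Summit.QuantumFields.BalabanUV.Beta.GAN24.Push4NestAux (decays_vertexW_of_locStencil abs_le_of_decays)
open Summit.QuantumFields.BalabanUV.Beta.GAN24.Push3 (push₃ push₃_inl_inl)
open Summit.QuantumFields.BalabanUV.Beta.GAN24.Push3GaugeSlotCells (tsum_comm_of_window)
open Summit.QuantumFields.BalabanUV.Beta.GAN24.SrecLinearPartEq (reslot reslot_inl_inl locStencil_reslot)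
open Summit.QuantumFields.BalabanUV.Beta.GAN24.Push3BorderGaugeSlotCells (vhSAt_inl_inr_eq_zero_of_not_mem_idx push₃_gaugeLeft_border)

noncomputable section

namespace Summit.QuantumFields.BalabanUV.Beta.GAN24.Push3BorderGaugeSlotCellsRight

variable {d : ℕ}
variable (l r w : Fin (d + 1) → (Fin (d + 1) → ℤ) → Fin (d + 1) → (Fin (d + 1) → ℤ) → ℝ)
variable (lam : Fin (d + 1) → (Fin (d + 1) → ℤ) → (Fin (d + 1) → ℤ) → ℝ)

/-! ## §1 Symmetry, window and size of the re-slotted border channels -/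

/-- [folklore] The `(inr, inl)` channel is the `(inl, inr)` channel with the table's two slots exchanged (`vhSAt_symm`). -/
theorem reslot_inr_inl_vhSAt_eq (ρ : Fin (d + 1) → ℤ) (L : ℕ) (κ : Fin (d + 1)) (u x z : Fin (d + 1) → ℤ) (a b : Fin (d + 1)) :
    reslot Sum.inr Sum.inl (vhSAt ρ d L rfl) κ u x z (Sum.inl a) (Sum.inl b)
      = reslot Sum.inl Sum.inr (vhSAt ρ d L rfl) κ u z x (Sum.inl b) (Sum.inl a) := by
  rw [reslot_inl_inl, reslot_inl_inl, vhSAt_symm]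

/-- [folklore] The table vertex inherits the symmetry. -/
theorem vertexW_border_symm (ρ : Fin (d + 1) → ℤ) (L : ℕ) (κ' : Fin (d + 1)) (u' x z : Fin (d + 1) → ℤ) (a b : Fin (d + 1)) :
    vertexW w (reslot Sum.inr Sum.inl (vhSAt ρ d L rfl)) κ' u' x z (Sum.inl a) (Sum.inl b)
      = vertexW w (reslot Sum.inl Sum.inr (vhSAt ρ d L rfl)) κ' u' z x (Sum.inl b) (Sum.inl a) := by
  simp only [vertexW_apply, reslot_inr_inl_vhSAt_eq]

/-- [folklore] THE WINDOW of the `(inr, inl)` channel: the vertex vanishes unless `x − z ∈ [−(2L−1), 0]^{d+1}` (the packed multiplier site is `x`, the fluctuation site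
`z` lies in the `2L`-box of its block; box root). -/
theorem vertexW_border_eq_zero_of_not_mem {L : ℕ} (hL : 1 ≤ L) {rr : Fin (d + 1) → ℕ} (hrr : rr ∈ box (d + 1) L) (κ' : Fin (d + 1))
    (u' : Fin (d + 1) → ℤ) {x z : Fin (d + 1) → ℤ} {a b : Fin (d + 1)}
    (hxz : x - z ∉ Fintype.piFinset fun _ : Fin (d + 1) => Finset.Icc (-(2 * (L : ℤ) - 1)) 0) :
    vertexW w (reslot Sum.inr Sum.inl (vhSAt (toSite rr) d L rfl)) κ' u' x z (Sum.inl a) (Sum.inl b) = 0 := by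
  rw [vertexW_border_symm]
  rw [vertexW_apply]
  refine Finset.sum_eq_zero fun κ _ => ?_
  have hz : ∀ u, vhSAt (toSite rr) d L rfl κ u z x (Sum.inl b) (Sum.inr a) = 0 := by
    intro u
    by_cases hx : off L x = 0
    · refine vhSAt_inl_inr_eq_zero_of_not_mem hrr κ u x b a (fun hzn => hxz ?_)
      rw [mem_nearBox] at hzn
      rw [Fintype.mem_piFinset]
      intro i
      rw [Finset.mem_Icc]
      have hxi : x i = (L : ℤ) * blk L x i := by
        have := congrArg (fun f => f i) (eq_smul_blk_of_off_eq_zero hL hx)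
        simpa [Pi.smul_apply, smul_eq_mul] using this
      obtain ⟨h1, h2⟩ := hzn i
      simp only [Pi.sub_apply]
      constructor <;> linarith
    · simp only [vhSAt, packVH_inl_inr, hx, if_false]
  simp only [reslot_inl_inl, hz, mul_zero, tsum_zero]

/-- [folklore] SIZE: for bounded table legs the re-slotted border vertex is bounded (an1's `locStencil_vhSAt`, `locStencil_reslot`, leaf-17's `decays_vertexW_of_locStencil`). -/
theorem exists_vertexW_border_bound {L : ℕ} (hL : 1 ≤ L) {rr : Fin (d + 1) → ℕ} (hrr : rr ∈ box (d + 1) L) {Cw : ℝ} (hw : ∀ κ' u' κ u, |w κ' u' κ u| ≤ Cw)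
    (σ τ : Fin (d + 1) → Fib d) (κ' : Fin (d + 1)) (u' : Fin (d + 1) → ℤ) :
    ∃ CV : ℝ, 0 ≤ CV ∧ ∀ x z a b, |vertexW w (reslot σ τ (vhSAt (toSite rr) d L rfl)) κ' u' x z a b| ≤ CV := by
  have hCw : 0 ≤ Cw := (abs_nonneg _).trans (hw 0 0 0 0)
  have hV := decays_vertexW_of_locStencil hw hCw (locStencil_reslot (locStencil_vhSAt hL hrr zero_le_one) σ τ) one_pos κ' u'
  exact ⟨_, (abs_nonneg _).trans (abs_le_of_decays hV one_half_pos.le 0 0 (Sum.inl 0) (Sum.inl 0)),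
    fun x z a b => abs_le_of_decays hV one_half_pos.le x z a b⟩

/-! ## §2 THE TABLE SLOT of the `reslot inr inl` channel (hypothesis-free) -/

/-- [folklore] The table vertex of the `(inr, inl)` channel through pure-gauge table legs:
`vertexW (dz λ) (reslot inr inl V) κ′ u′ x z (inl a) (inl b) = (λ_{κ′u′}(x + ρ) − λ_{κ′u′} z) · q(z,x)(inl b)(inr a)`. -/
theorem vertexW_dz_border' {L : ℕ} (hL : 1 ≤ L) {rr : Fin (d + 1) → ℕ} (hrr : rr ∈ box (d + 1) L) (κ' : Fin (d + 1)) (u' x z : Fin (d + 1) → ℤ)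
    (a b : Fin (d + 1)) :
    vertexW (fun κ y κ₁ u => dz (lam κ y) κ₁ u) (reslot Sum.inr Sum.inl (vhSAt (toSite rr) d L rfl)) κ' u' x z (Sum.inl a) (Sum.inl b)
      = (lam κ' u' (x + toSite rr) - lam κ' u' z) * linSymAt (toSite rr) L z x (Sum.inl b) (Sum.inr a) := by
  rw [vertexW_border_symm, Push3BorderGaugeSlotCells.vertexW_dz_border lam hL hrr]

/-- [folklore] **THE TABLE SLOT of the `(inr, inl)` channel** (hypothesis-free): `push₃ l r (dz λ) (reslot inr inl V) κ′ u′ x′ z′ (inl α) (inl β)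
  = Σ'_z Σ_b r β z′ b z · Σ'_x Σ_a l α x′ a x · ((λ_{κ′u′}(x + ρ) − λ_{κ′u′} z) · q(z,x)(inl b)(inr a))` — the dressed field leg `r` OUTER over the fine slot `z`, the
multiplier leg `l` INSIDE over the packed slot `x`. -/
theorem push₃_gaugeTable_border' {L : ℕ} (hL : 1 ≤ L) {rr : Fin (d + 1) → ℕ} (hrr : rr ∈ box (d + 1) L) (κ' : Fin (d + 1))
    (u' x' z' : Fin (d + 1) → ℤ) (α β : Fin (d + 1)) :
    push₃ l r (fun κ y κ₁ u => dz (lam κ y) κ₁ u) (reslot Sum.inr Sum.inl (vhSAt (toSite rr) d L rfl)) κ' u' x' z' (Sum.inl α) (Sum.inl β)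
      = ∑' z, ∑ b, r β z' b z * ∑' x, ∑ a, l α x' a x *
          ((lam κ' u' (x + toSite rr) - lam κ' u' z) * linSymAt (toSite rr) L z x (Sum.inl b) (Sum.inr a)) := by
  rw [push₃_inl_inl]
  refine tsum_congr fun z => Finset.sum_congr rfl fun b _ => ?_
  rw [mul_comm]
  congr 1
  refine tsum_congr fun x => Finset.sum_congr rfl fun a _ => ?_
  rw [vertexW_dz_border' lam hL hrr]

/-- [folklore] **ITS BOUND** (`ContactOneGaugeCellBorder.abs_cell_border_le`'s nesting: the fine leg `r β z′ = T` OUTER with `|T b z| ≤ E₁E_{z₁}(z)`, the packed multiplier leg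
`l α x′ = M` INSIDE with `|M a x| ≤ E₃E_{z₃}(x)`, gauge `λ κ′ u′ = ψ` under `EψE_{z₀}`):
`|Σ'_z Σ_b T b z · Σ'_x Σ_a M a x · ((ψ(x + ρ) − ψ z)·q(z,x)(inl b)(inr a))| ≤ (d+1)²·2^{d+1}·e^{2κ₀(d+1)L}·E₁E₃·(2Eψ·e^{2κ₀(d+1)L}·ℓ)·(N^{d+1}·Zl·e^{−(κ₀∕12)·spread})`. -/
theorem abs_cellVidx_le'' {N L : ℕ} {κ₀ : ℝ} {rr : Fin (d + 1) → ℕ} (hN : 1 ≤ N) (hκ : 0 < κ₀) (hL : 1 ≤ L) (hrr : rr ∈ box (d + 1) L)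
    {T M : Form1 (d + 1) ℝ} {ψ : (Fin (d + 1) → ℤ) → ℝ} {z₀ z₁ z₃ : Fin (d + 1) → ℤ} {E₁ E₃ Eψ : ℝ} (hE₁ : 0 ≤ E₁) (hE₃ : 0 ≤ E₃) (hEψ : 0 ≤ Eψ)
    (hT : ∀ b z, |T b z| ≤ E₁ * Real.exp (-(κ₀ * supNorm (quo N z - z₁))))
    (hM : ∀ a x, |M a x| ≤ E₃ * Real.exp (-(κ₀ * supNorm (quo N x - z₃))))
    (hψ : ∀ x, |ψ x| ≤ Eψ * Real.exp (-(κ₀ * supNorm (quo N x - z₀)))) :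
    |∑' z, ∑ b, T b z * ∑' x, ∑ a, M a x * ((ψ (x + toSite rr) - ψ z) * linSymAt (toSite rr) L z x (Sum.inl b) (Sum.inr a))| ≤
      ((d : ℝ) + 1) ^ 2 * 2 ^ (d + 1) * Real.exp (κ₀ * (((d : ℝ) + 1) * (2 * (L : ℝ)))) * E₁ * E₃ *
        (2 * Eψ * Real.exp (κ₀ * (((d : ℝ) + 1) * (2 * (L : ℝ)))) * (ell (d + 1) L : ℝ)) *
        ((N : ℝ) ^ (d + 1) * Zl (d + 1) (κ₀ / (4 * ((d : ℝ) + 1))) * Real.exp (-(κ₀ / 12) * (supNorm (z₁ - z₀) + supNorm (z₃ - z₀)))) :=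
  (abs_cell_border_le hN hκ hL hrr (T := T) (M := M) (K := fun b z a x =>
      (ψ (x + toSite rr) - ψ z) * linSymAt (toSite rr) L z x (Sum.inl b) (Sum.inr a))
    hE₁ hE₃ (by positivity) hT hM (fun b z a x h hq => h (by simp only [hq, mul_zero]))
    (fun b z a x => abs_idxWeight_mul_linSymAt_le hN hκ.le hL hrr hEψ hψ b z a x)).2

/-! ## §3 TRANSPOSITION on the summable class; the RIGHT SLOT of the `reslot inr inl` channel -/

variable {l r w lam}

/-- [folklore] **THE PUSH OF THE BORDER TABLE's `(inr, inl)` CHANNEL IS THE PUSH OF ITS `(inl, inr)` CHANNEL WITH THE TWO KERNEL LEGS (and coarse arguments)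
EXCHANGED**, ON THE SUMMABLE CLASS (left legs `l` with SUMMABLE fine rows, right legs `r` and table legs `w` BOUNDED; box root):
`push₃ l r w (reslot inr inl V) κ′ u′ x′ z′ (inl α) (inl β) = push₃ r l w (reslot inl inr V) κ′ u′ z′ x′ (inl β) (inl α)` (an1's `vhSAt_symm` entrywise + ONE genuine exchange of the
two kernel-leg sums, leaf-01's `tsum_comm_of_window` on the window `[−(2L−1), 0]^{d+1}` with the shifted-diagonal majorant `Σ_{a,b} |l α x′ a (z+t)|·C_V·C_r`). -/
theorem push₃_transpose_border {L : ℕ} (hL : 1 ≤ L) {rr : Fin (d + 1) → ℕ} (hrr : rr ∈ box (d + 1) L) (hls : ∀ α x' κ, Summable fun x => l α x' κ x)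
    {Cr Cw : ℝ} (hr : ∀ β z' κ z, |r β z' κ z| ≤ Cr) (hw : ∀ κ' u' κ u, |w κ' u' κ u| ≤ Cw) (κ' : Fin (d + 1)) (u' x' z' : Fin (d + 1) → ℤ)
    (α β : Fin (d + 1)) :
    push₃ l r w (reslot Sum.inr Sum.inl (vhSAt (toSite rr) d L rfl)) κ' u' x' z' (Sum.inl α) (Sum.inl β)
      = push₃ r l w (reslot Sum.inl Sum.inr (vhSAt (toSite rr) d L rfl)) κ' u' z' x' (Sum.inl β) (Sum.inl α) := by
  classical
  set S := reslot Sum.inr Sum.inl (vhSAt (toSite rr) d L rfl) with hSdef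
  set S' := reslot Sum.inl Sum.inr (vhSAt (toSite rr) d L rfl) with hS'def
  set Twin : Finset (Fin (d + 1) → ℤ) := Fintype.piFinset fun _ : Fin (d + 1) => Finset.Icc (-(2 * (L : ℤ) - 1)) 0 with hTwin
  have hCr : 0 ≤ Cr := (abs_nonneg _).trans (hr 0 0 0 0)
  obtain ⟨CV, hCV0, hVb⟩ := exists_vertexW_border_bound w hL hrr hw Sum.inr Sum.inl κ' u'
  -- window: `vertexW w S κ′ u′ x z (inl a) (inl b) = 0` unless `x − z ∈ Twin`; by symmetry the same controls `S'` at `(z, x)`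
  have hwin : ∀ {x z : Fin (d + 1) → ℤ} {a b : Fin (d + 1)}, x - z ∉ Twin → vertexW w S κ' u' x z (Sum.inl a) (Sum.inl b) = 0 :=
    fun hxz => vertexW_border_eq_zero_of_not_mem w hL hrr κ' u' hxz
  -- finite support of the inner sums
  have hsxV : ∀ z a b, Summable fun x => l α x' a x * vertexW w S κ' u' x z (Sum.inl a) (Sum.inl b) := by
    intro z a b
    refine summable_of_finsupp (Twin.image fun t => z + t) fun x hx => ?_
    have hx' : x - z ∉ Twin := fun h => hx (Finset.mem_image.2 ⟨x - z, h, by abel⟩)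
    rw [hwin hx', mul_zero]
  have hszV : ∀ x a b, Summable fun z => r β z' b z * vertexW w S' κ' u' z x (Sum.inl b) (Sum.inl a) := by
    intro x a b
    refine summable_of_finsupp (Twin.image fun t => x - t) fun z hz => ?_
    have hz' : x - z ∉ Twin := fun h => hz (Finset.mem_image.2 ⟨x - z, h, by abel⟩)
    rw [hS'def, ← vertexW_border_symm, ← hSdef, hwin hz', mul_zero]
  -- Θ x z := Σ_a Σ_b l α x′ a x · V x z a b · r β z′ b z
  have h1 : ∀ z, (∑ b, (∑' x, ∑ a, l α x' a x * vertexW w S κ' u' x z (Sum.inl a) (Sum.inl b)) * r β z' b z)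
      = ∑' x, ∑ a, ∑ b, l α x' a x * vertexW w S κ' u' x z (Sum.inl a) (Sum.inl b) * r β z' b z := by
    intro z
    calc (∑ b, (∑' x, ∑ a, l α x' a x * vertexW w S κ' u' x z (Sum.inl a) (Sum.inl b)) * r β z' b z)
        = ∑ b, ∑ a, ∑' x, l α x' a x * vertexW w S κ' u' x z (Sum.inl a) (Sum.inl b) * r β z' b z := by
          refine Finset.sum_congr rfl fun b _ => ?_
          rw [Summable.tsum_finsetSum fun a _ => hsxV z a b, Finset.sum_mul]
          refine Finset.sum_congr rfl fun a _ => ?_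
          rw [← tsum_mul_right]
      _ = ∑ b, ∑' x, ∑ a, l α x' a x * vertexW w S κ' u' x z (Sum.inl a) (Sum.inl b) * r β z' b z := by
          refine Finset.sum_congr rfl fun b _ => ?_
          rw [Summable.tsum_finsetSum fun a _ => (hsxV z a b).mul_right _]
      _ = ∑' x, ∑ b, ∑ a, l α x' a x * vertexW w S κ' u' x z (Sum.inl a) (Sum.inl b) * r β z' b z := by
          rw [Summable.tsum_finsetSum fun b _ => summable_sum fun a _ => (hsxV z a b).mul_right _]
      _ = _ := tsum_congr fun x => Finset.sum_comm
  have h2 : ∀ x, (∑ a, (∑' z, ∑ b, r β z' b z * vertexW w S' κ' u' z x (Sum.inl b) (Sum.inl a)) * l α x' a x)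
      = ∑' z, ∑ a, ∑ b, l α x' a x * vertexW w S κ' u' x z (Sum.inl a) (Sum.inl b) * r β z' b z := by
    intro x
    calc (∑ a, (∑' z, ∑ b, r β z' b z * vertexW w S' κ' u' z x (Sum.inl b) (Sum.inl a)) * l α x' a x)
        = ∑ a, ∑ b, ∑' z, r β z' b z * vertexW w S' κ' u' z x (Sum.inl b) (Sum.inl a) * l α x' a x := by
          refine Finset.sum_congr rfl fun a _ => ?_
          rw [Summable.tsum_finsetSum fun b _ => hszV x a b, Finset.sum_mul]
          refine Finset.sum_congr rfl fun b _ => ?_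
          rw [← tsum_mul_right]
      _ = ∑ a, ∑' z, ∑ b, r β z' b z * vertexW w S' κ' u' z x (Sum.inl b) (Sum.inl a) * l α x' a x := by
          refine Finset.sum_congr rfl fun a _ => ?_
          rw [Summable.tsum_finsetSum fun b _ => (hszV x a b).mul_right _]
      _ = ∑' z, ∑ a, ∑ b, r β z' b z * vertexW w S' κ' u' z x (Sum.inl b) (Sum.inl a) * l α x' a x := by
          rw [Summable.tsum_finsetSum fun a _ => summable_sum fun b _ => (hszV x a b).mul_right _]
      _ = _ := by
          refine tsum_congr fun z => Finset.sum_congr rfl fun a _ => Finset.sum_congr rfl fun b _ => ?_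
          rw [hS'def, ← vertexW_border_symm, ← hSdef]
          ring
  rw [push₃_inl_inl, push₃_inl_inl, tsum_congr h1, tsum_congr h2]
  -- the genuine exchange
  refine tsum_comm_of_window (Θ := fun x z => ∑ a, ∑ b, l α x' a x * vertexW w S κ' u' x z (Sum.inl a) (Sum.inl b) * r β z' b z)
    Twin (fun x z hxz => ?_) (fun t _ => ?_)
  · exact Finset.sum_eq_zero fun a _ => Finset.sum_eq_zero fun b _ => by rw [hwin hxz, mul_zero, zero_mul]
  · have hls' : ∀ a, Summable fun z => |l α x' a (z + t)| * (CV * Cr) := by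
      intro a
      have h := ((Equiv.addRight t).summable_iff.2 (hls α x' a)).abs.mul_right (CV * Cr)
      exact h.congr fun z => by simp only [Function.comp_apply, Equiv.coe_addRight]
    have hg : Summable fun z => ∑ a : Fin (d + 1), ∑ _b : Fin (d + 1), |l α x' a (z + t)| * (CV * Cr) :=
      summable_sum fun a _ => summable_sum fun _ _ => hls' a
    refine Summable.of_norm_bounded hg (fun z => ?_)
    rw [Real.norm_eq_abs]
    refine (Finset.abs_sum_le_sum_abs _ _).trans (Finset.sum_le_sum fun a _ => ?_)
    refine (Finset.abs_sum_le_sum_abs _ _).trans (Finset.sum_le_sum fun b _ => ?_)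
    rw [abs_mul, abs_mul, mul_assoc]
    exact mul_le_mul_of_nonneg_left (mul_le_mul (hVb _ _ _ _) (hr β z' b z) (abs_nonneg _) hCV0) (abs_nonneg _)

/-- [folklore] **THE RIGHT SLOT of the `(inr, inl)` channel** on the summable class (left legs `l` — the UNDRESSED multiplier rows — with SUMMABLE fine rows, table legs
`w` BOUNDED, gauge increments `dz (λ μ y)` BOUNDED): `push₃ l (dz λ) w (reslot inr inl V) κ′ u′ x′ z′ (inl α) (inl β)
  = Σ'_x Σ_a l α x′ a x · Σ'_u Σ_κ w κ′ u′ κ u · ((λ_{βz′}(u + e_κ) − λ_{βz′}(x + ρ + L·e_a)) · q(u,x)(inl κ)(inr a))` — multiplier leg OUTER: part 1's `abs_cellVflu_le'` bounds it. -/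
theorem push₃_gaugeRight_border {L : ℕ} (hL : 1 ≤ L) {rr : Fin (d + 1) → ℕ} (hrr : rr ∈ box (d + 1) L) (hls : ∀ α x' κ, Summable fun x => l α x' κ x)
    {Cg Cw : ℝ} (hlam : ∀ μ y κ u, |dz (lam μ y) κ u| ≤ Cg) (hw : ∀ κ' u' κ u, |w κ' u' κ u| ≤ Cw) (κ' : Fin (d + 1))
    (u' x' z' : Fin (d + 1) → ℤ) (α β : Fin (d + 1)) :
    push₃ l (fun μ y κ u => dz (lam μ y) κ u) w (reslot Sum.inr Sum.inl (vhSAt (toSite rr) d L rfl)) κ' u' x' z' (Sum.inl α) (Sum.inl β)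
      = ∑' x, ∑ a, l α x' a x * ∑' u, ∑ κ, w κ' u' κ u *
          ((lam β z' (u + unitVec κ) - lam β z' (x + toSite rr + (L : ℤ) • unitVec a)) * linSymAt (toSite rr) L u x (Sum.inl κ) (Sum.inr a)) := by
  rw [push₃_transpose_border hL hrr (r := fun μ y κ u => dz (lam μ y) κ u) hls hlam hw]
  exact push₃_gaugeLeft_border l w lam hL hrr κ' u' z' x' β α

end Summit.QuantumFields.BalabanUV.Beta.GAN24.Push3BorderGaugeSlotCellsRight

end
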